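import Mathlib
import HarnessLib
import Literature.Analysis.FluidPDE.SuitableWeak
import Literature.Analysis.FluidPDE.LocalTypeI
import Literature.Analysis.FluidPDE.LocalTypeILscGradient
import Literature.Analysis.FluidPDE.LocalTypeILscGradientTools
import Literature.Analysis.FunctionSpaces.TestFunctionDensity

/-!
# Route QuarterBudgetTrace, support `BudgetedExtinctApex` (stmt-NavierStokesRegularity-26014) — brick «ZoomBudgetInheritance»,
# part 1: weak lower semicontinuity of the gradient energy on an ARBITRARY open set

Seat ns-es-p1 g3 (director-ns KEY-NS #81 (1)); planner of record ns-idea-9 g2.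

* `lintegral_frobeniusNormSq_le_of_tendsto_eLpNorm` — the tree's `cknE_le_of_tendsto_eLpNorm`
  (`Literature.Analysis.FluidPDE.LocalTypeILscGradient`, Albritton–Barker 2019 §3 «(3.6) from (3.3)» for the dissipation `E`)
  for a GENERAL open `Ω ⊆ Q₀` instead of a parabolic cylinder: if `v_k → u` in `L³(Q₀)`, `G_k`, `G` are weak spatial gradients
  of `v_k`, `u` on `Ω` with `∇u ∈ L²(Ω)`, and `∫_Ω |G_k|²_F ≤ A` for all `k`, then `∫_Ω |G|²_F ≤ A`.  Same proof (distributional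
  convergence of the gradients `setIntegral_inner_coeffVec_eq` / `tendsto_integral_mul_inner_of_tendsto_eLpNorm`, Cauchy–Schwarz,
  density of test fields `exists_isTestFunctionOn_tendsto_eLpNorm_sub`), with the cylinder and the normalisation `r⁻¹` removed.
  Part 2 (`…QuarterBudgetTraceZoomBudgetInheritance`) applies it on the exhaustion `(−r²,0) × B(0, m+1)` of a slab.

WHAT THIS IS NOT: not `BudgetedExtinctApex`, not a statement about EQL (1574) / NTC (18381), not NS regularity — a functional-
analytic tool.  No summit statement is proved here.  [AlbrittonBarker2019 §3; Brezis 2011 Prop. 3.5 (iii), Cor. 4.23]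
-/

noncomputable section

-- the summit and its single sub-problem share the name (CONVENTIONS §1), as in every Theorems file
set_option linter.dupNamespace false

namespace Summit.NavierStokesRegularity.NavierStokesRegularity.Theorems.QuarterBudgetTraceGradientLsc

open MeasureTheory Set Function Filter Topology TopologicalSpace Metric
open scoped NNReal ENNReal InnerProductSpace RealInnerProductSpace
open Literature.Analysis Literature.Analysis.FluidPDE

section Lsc

variable {E : Type*} [NormedAddCommGroup E] [InnerProductSpace ℝ E] [FiniteDimensional ℝ E]
  [MeasurableSpace E] [BorelSpace E]

/-- **Weak lower semicontinuity of the gradient energy on an open set** (the tree's `cknE_le_of_tendsto_eLpNorm`,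
Albritton–Barker 2019 §3, for a general open `Ω ⊆ Q₀`): `v_k → u` in `L³(Q₀)`, `G_k`, `Gu` weak spatial gradients of
`v_k`, `u` on `Ω` with `∫_Ω |Gu|²_F < ∞`, and `∫_Ω |G_k|²_F ≤ A` for all `k` ⇒ `∫_Ω |Gu|²_F ≤ A`. -/
theorem lintegral_frobeniusNormSq_le_of_tendsto_eLpNorm {Ω : Opens (ℝ × E)} {Q₀ : Set (ℝ × E)}
    {v : ℕ → ℝ → E → E} {u : ℝ → E → E} {G : ℕ → ℝ → E → E →L[ℝ] E} {Gu : ℝ → E → E →L[ℝ] E}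
    {A : ℝ≥0∞} (hΩQ : (Ω : Set (ℝ × E)) ⊆ Q₀)
    (hG : ∀ k, HasWeakSpatialGradientOn Ω (v k) (G k))
    (hGu : HasWeakSpatialGradientOn Ω u Gu)
    (hGu2 : ∫⁻ w in (Ω : Set (ℝ × E)), ENNReal.ofReal (frobeniusNormSq (Gu w.1 w.2)) < ∞)
    (hconv : Tendsto (fun k => eLpNorm (uncurry (v k) - uncurry u) 3 (volume.restrict Q₀)) atTop (𝓝 0))
    (hbound : ∀ k, ∫⁻ w in (Ω : Set (ℝ × E)), ENNReal.ofReal (frobeniusNormSq (G k w.1 w.2)) ≤ A) :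
    ∫⁻ w in (Ω : Set (ℝ × E)), ENNReal.ofReal (frobeniusNormSq (Gu w.1 w.2)) ≤ A := by
  -- adapted from Literature/Analysis/FluidPDE/LocalTypeILscGradient.lean (`cknE_le_of_tendsto_eLpNorm`)
  rcases eq_or_ne A ⊤ with rfl | hAtop
  · exact le_top
  set μ' : Measure (ℝ × E) := volume.restrict (Ω : Set (ℝ × E)) with hμ'
  have hGk : ∀ k, ∫⁻ w, ENNReal.ofReal (frobeniusNormSq (G k w.1 w.2)) ∂μ' ≤ A := hbound
  -- the coefficient fields
  set b := stdOrthonormalBasis ℝ E with hb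
  set cv : (E →L[ℝ] E) → EuclideanSpace ℝ (Fin (Module.finrank ℝ E) × Fin (Module.finrank ℝ E)) :=
    fun L => WithLp.toLp 2 fun ij => ⟪L (b ij.1), b ij.2⟫ with hcv
  have hcvc : Continuous cv := by
    rw [hcv]
    fun_prop
  have hcvn : ∀ L, ‖cv L‖ₑ ^ (2 : ℝ) = ENNReal.ofReal (frobeniusNormSq L) := fun L => by
    rw [← ofReal_norm, ENNReal.ofReal_rpow_of_nonneg (norm_nonneg _) (by norm_num), Real.rpow_two,
      hcv, norm_sq_coeffVec_std]
  set F : ℝ × E → EuclideanSpace ℝ (Fin (Module.finrank ℝ E) × Fin (Module.finrank ℝ E)) :=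
    fun w => cv (Gu w.1 w.2) with hF
  set Fk : ℕ → ℝ × E → EuclideanSpace ℝ (Fin (Module.finrank ℝ E) × Fin (Module.finrank ℝ E)) :=
    fun k w => cv (G k w.1 w.2) with hFk
  have hF_enorm : ∀ w, ‖F w‖ₑ ^ (2 : ℝ) = ENNReal.ofReal (frobeniusNormSq (Gu w.1 w.2)) :=
    fun w => hcvn (Gu w.1 w.2)
  have hFk_enorm : ∀ k w, ‖Fk k w‖ₑ ^ (2 : ℝ) = ENNReal.ofReal (frobeniusNormSq (G k w.1 w.2)) :=
    fun k w => hcvn (G k w.1 w.2)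
  have hFm : AEStronglyMeasurable F μ' :=
    hcvc.comp_aestronglyMeasurable hGu.locallyIntegrableOn_grad.aestronglyMeasurable
  have hFkm : ∀ k, AEStronglyMeasurable (Fk k) μ' := fun k =>
    hcvc.comp_aestronglyMeasurable (hG k).locallyIntegrableOn_grad.aestronglyMeasurable
  -- `L²` bookkeeping
  have h2eq : ∀ Φ : ℝ × E → EuclideanSpace ℝ (Fin (Module.finrank ℝ E) × Fin (Module.finrank ℝ E)),
      eLpNorm Φ 2 μ' = (∫⁻ w, ‖Φ w‖ₑ ^ (2 : ℝ) ∂μ') ^ (1 / 2 : ℝ) := fun Φ => by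
    rw [eLpNorm_eq_lintegral_rpow_enorm_toReal two_ne_zero ENNReal.ofNat_ne_top,
      ENNReal.toReal_ofNat]
  set N := ∫⁻ w, ‖F w‖ₑ ^ (2 : ℝ) ∂μ' with hN
  have hNeq : N = ∫⁻ w, ENNReal.ofReal (frobeniusNormSq (Gu w.1 w.2)) ∂μ' :=
    lintegral_congr hF_enorm
  have hNtop : N ≠ ⊤ := by rw [hNeq]; exact hGu2.ne
  have hNk : ∀ k, ∫⁻ w, ‖Fk k w‖ₑ ^ (2 : ℝ) ∂μ' ≤ A := fun k => by
    rw [lintegral_congr (hFk_enorm k)]; exact hGk k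
  have hFN : eLpNorm F 2 μ' = N ^ (1 / 2 : ℝ) := h2eq F
  have hFmem : MemLp F 2 μ' :=
    ⟨hFm, by rw [hFN]; exact ENNReal.rpow_lt_top_of_nonneg (by norm_num) hNtop⟩
  have hFkN : ∀ k, eLpNorm (Fk k) 2 μ' ≤ A ^ (1 / 2 : ℝ) := fun k => by
    rw [h2eq]; exact ENNReal.rpow_le_rpow (hNk k) (by norm_num)
  -- Cauchy–Schwarz for pairings
  have hCS :
      ∀ Φ₁ Φ₂ : ℝ × E → EuclideanSpace ℝ (Fin (Module.finrank ℝ E) × Fin (Module.finrank ℝ E)),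
      AEStronglyMeasurable Φ₁ μ' → AEStronglyMeasurable Φ₂ μ' →
      ‖∫ w, ⟪Φ₁ w, Φ₂ w⟫ ∂μ'‖ₑ ≤ eLpNorm Φ₁ 2 μ' * eLpNorm Φ₂ 2 μ' := by
    intro Φ₁ Φ₂ h₁ h₂
    refine (enorm_integral_le_lintegral_enorm _).trans ?_
    have hH := ENNReal.lintegral_mul_le_Lp_mul_Lq μ'
      (Real.holderConjugate_iff.2 ⟨by norm_num, by norm_num⟩ : (2 : ℝ).HolderConjugate 2)
      h₁.aemeasurable.enorm h₂.aemeasurable.enorm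
    simp only [Pi.mul_apply] at hH
    calc ∫⁻ w, ‖⟪Φ₁ w, Φ₂ w⟫‖ₑ ∂μ' ≤ ∫⁻ w, ‖Φ₁ w‖ₑ * ‖Φ₂ w‖ₑ ∂μ' := by
          refine lintegral_mono fun w => ?_
          rw [← ofReal_norm, ← ofReal_norm, ← ofReal_norm, ← ENNReal.ofReal_mul (norm_nonneg _)]
          exact ENNReal.ofReal_le_ofReal (norm_inner_le_norm _ _)
      _ ≤ (∫⁻ w, ‖Φ₁ w‖ₑ ^ (2 : ℝ) ∂μ') ^ (1 / 2 : ℝ) *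
            (∫⁻ w, ‖Φ₂ w‖ₑ ^ (2 : ℝ) ∂μ') ^ (1 / 2 : ℝ) := hH
      _ = eLpNorm Φ₁ 2 μ' * eLpNorm Φ₂ 2 μ' := by rw [h2eq, h2eq]
  -- integrability of pairings of `L²` fields
  have hint :
      ∀ Φ₁ Φ₂ : ℝ × E → EuclideanSpace ℝ (Fin (Module.finrank ℝ E) × Fin (Module.finrank ℝ E)),
      MemLp Φ₁ 2 μ' → MemLp Φ₂ 2 μ' → Integrable (fun w => ⟪Φ₁ w, Φ₂ w⟫) μ' := by
    intro Φ₁ Φ₂ h₁ h₂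
    refine Integrable.mono' (h₁.norm.integrable_mul h₂.norm) (h₁.1.inner h₂.1)
      (ae_of_all _ fun w => ?_)
    exact norm_inner_le_norm _ _
  -- Step 1: pairings with a test field converge
  have hpair : ∀ Ψ : ℝ × E → EuclideanSpace ℝ (Fin (Module.finrank ℝ E) × Fin (Module.finrank ℝ E)),
      FunctionSpaces.IsTestFunctionOn Ω Ψ →
      Tendsto (fun k => ∫ w, ⟪Fk k w, Ψ w⟫ ∂μ') atTop (𝓝 (∫ w, ⟪F w, Ψ w⟫ ∂μ')) := by
    intro Ψ hΨ
    have ek : ∀ k, ∫ w, ⟪Fk k w, Ψ w⟫ ∂μ' =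
        -∑ ij : Fin (Module.finrank ℝ E) × Fin (Module.finrank ℝ E),
        ∫ w : ℝ × E, fderiv ℝ (fun x => Ψ (w.1, x) ij) w.2 (b ij.1) * ⟪v k w.1 w.2, b ij.2⟫ :=
      fun k => setIntegral_inner_coeffVec_eq (hG k) b hΨ
    have e : ∫ w, ⟪F w, Ψ w⟫ ∂μ' = -∑ ij : Fin (Module.finrank ℝ E) × Fin (Module.finrank ℝ E),
        ∫ w : ℝ × E, fderiv ℝ (fun x => Ψ (w.1, x) ij) w.2 (b ij.1) * ⟪u w.1 w.2, b ij.2⟫ :=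
      setIntegral_inner_coeffVec_eq hGu b hΨ
    simp_rw [ek, e]
    refine Tendsto.neg (tendsto_finsetSum _ fun ij _ => ?_)
    obtain ⟨hθc, hθcs, hθΩ⟩ := fderiv_coord_weight hΨ ij (b ij.1)
    exact tendsto_integral_mul_inner_of_tendsto_eLpNorm hΩQ (fun k => (hG k).locallyIntegrableOn)
      hGu.locallyIntegrableOn hconv hθc hθcs hθΩ (b ij.2)
  -- Step 2: the bound survives the limit in `k`
  have hlim : ∀ Ψ : ℝ × E → EuclideanSpace ℝ (Fin (Module.finrank ℝ E) × Fin (Module.finrank ℝ E)),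
      FunctionSpaces.IsTestFunctionOn Ω Ψ →
      ‖∫ w, ⟪F w, Ψ w⟫ ∂μ'‖ₑ ≤ A ^ (1 / 2 : ℝ) * eLpNorm Ψ 2 μ' := by
    intro Ψ hΨ
    have hΨm : AEStronglyMeasurable Ψ μ' := hΨ.contDiff.continuous.aestronglyMeasurable
    refine le_of_tendsto' (hpair Ψ hΨ).enorm fun k => ?_
    exact (hCS _ _ (hFkm k) hΨm).trans (mul_le_mul' (hFkN k) le_rfl)
  -- Step 3: density of test fields in `L²(Ω)`
  obtain ⟨Ψ, hΨ, hΨlim⟩ := FunctionSpaces.exists_isTestFunctionOn_tendsto_eLpNorm_sub Ω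
    (μ := volume) (p := 2) (by norm_num) (by norm_num) hFmem
  have hΨmem : ∀ n, MemLp (Ψ n) 2 μ' := fun n =>
    ((hΨ n).contDiff.continuous.memLp_of_hasCompactSupport (hΨ n).hasCompactSupport).restrict _
  -- (a) `∫ ⟪F, Ψ n⟫ → ∫ ⟪F, F⟫`
  have ha : Tendsto (fun n => ∫ w, ⟪F w, Ψ n w⟫ ∂μ') atTop (𝓝 (∫ w, ⟪F w, F w⟫ ∂μ')) := by
    rw [tendsto_iff_edist_tendsto_0]
    have hb : ∀ n, edist (∫ w, ⟪F w, Ψ n w⟫ ∂μ') (∫ w, ⟪F w, F w⟫ ∂μ') ≤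
        eLpNorm F 2 μ' * eLpNorm (F - Ψ n) 2 μ' := by
      intro n
      rw [edist_eq_enorm_sub, ← integral_sub (hint _ _ hFmem (hΨmem n)) (hint _ _ hFmem hFmem)]
      have e : (fun w => ⟪F w, Ψ n w⟫ - ⟪F w, F w⟫) = fun w => ⟪F w, (Ψ n - F) w⟫ := by
        funext w; rw [Pi.sub_apply, inner_sub_right]
      rw [e, eLpNorm_sub_comm]
      exact hCS _ _ hFm ((hΨmem n).1.sub hFm)
    have h0 : Tendsto (fun n => eLpNorm F 2 μ' * eLpNorm (F - Ψ n) 2 μ') atTop (𝓝 0) := by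
      have h := ENNReal.Tendsto.const_mul hΨlim (Or.inr hFmem.eLpNorm_ne_top)
      rwa [mul_zero] at h
    exact tendsto_of_tendsto_of_tendsto_of_le_of_le tendsto_const_nhds h0 (fun n => bot_le) hb
  -- (b) `‖∫ ⟪F, F⟫‖ₑ = N`
  have hNint : ‖∫ w, ⟪F w, F w⟫ ∂μ'‖ₑ = N := by
    have e : (fun w => ⟪F w, F w⟫) = fun w => ‖F w‖ ^ 2 := by
      funext w; exact real_inner_self_eq_norm_sq (F w)
    have hnn : 0 ≤ ∫ w, ⟪F w, F w⟫ ∂μ' := by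
      rw [e]; exact integral_nonneg fun w => by positivity
    rw [Real.enorm_eq_ofReal hnn, e, ofReal_integral_eq_lintegral_ofReal
      (by rw [← e]; exact hint _ _ hFmem hFmem) (ae_of_all _ fun w => by positivity)]
    refine lintegral_congr fun w => ?_
    rw [← ofReal_norm, ENNReal.ofReal_rpow_of_nonneg (norm_nonneg _) (by norm_num), Real.rpow_two]
  -- (c) the bound along the density sequence and its limit: `N ≤ A^{1/2} N^{1/2}`
  have hkey : N ≤ A ^ (1 / 2 : ℝ) * N ^ (1 / 2 : ℝ) := by
    have hbn : ∀ n, ‖∫ w, ⟪F w, Ψ n w⟫ ∂μ'‖ₑ ≤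
        A ^ (1 / 2 : ℝ) * (eLpNorm F 2 μ' + eLpNorm (F - Ψ n) 2 μ') := by
      intro n
      refine (hlim (Ψ n) (hΨ n)).trans ?_
      gcongr
      calc eLpNorm (Ψ n) 2 μ' = eLpNorm (F - (F - Ψ n)) 2 μ' := by rw [sub_sub_cancel]
        _ ≤ eLpNorm F 2 μ' + eLpNorm (F - Ψ n) 2 μ' :=
            eLpNorm_sub_le hFm (hFm.sub (hΨmem n).1) one_le_two
    have hR : Tendsto (fun n => A ^ (1 / 2 : ℝ) * (eLpNorm F 2 μ' + eLpNorm (F - Ψ n) 2 μ')) atTop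
        (𝓝 (A ^ (1 / 2 : ℝ) * eLpNorm F 2 μ')) := by
      have h1 : Tendsto (fun n => eLpNorm F 2 μ' + eLpNorm (F - Ψ n) 2 μ') atTop
          (𝓝 (eLpNorm F 2 μ')) := by
        have h := (tendsto_const_nhds (x := eLpNorm F 2 μ') (f := (atTop : Filter ℕ))).add hΨlim
        rwa [add_zero] at h
      exact ENNReal.Tendsto.const_mul h1
        (Or.inr (ENNReal.rpow_ne_top_of_nonneg (by norm_num) hAtop))
    have h := le_of_tendsto_of_tendsto' ha.enorm hR hbn
    rwa [hNint, hFN] at h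
  -- (d) `N ≤ A`
  have hNA : N ≤ A := by
    rcases eq_or_ne N 0 with hN0 | hN0
    · rw [hN0]; exact zero_le
    have h12 : N ^ (1 / 2 : ℝ) ≠ 0 := by
      intro h
      rcases ENNReal.rpow_eq_zero_iff.1 h with ⟨h0, -⟩ | ⟨-, hneg⟩
      · exact hN0 h0
      · norm_num at hneg
    have h12' : N ^ (1 / 2 : ℝ) ≠ ∞ := ENNReal.rpow_ne_top_of_nonneg (by norm_num) hNtop
    have h1 : N ^ (1 / 2 : ℝ) ≤ A ^ (1 / 2 : ℝ) := by
      have e : N ^ (1 / 2 : ℝ) * N ^ (1 / 2 : ℝ) = N := by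
        rw [← ENNReal.rpow_add _ _ hN0 hNtop]; norm_num
      rw [← ENNReal.mul_le_mul_iff_left h12 h12', e]
      exact hkey
    have := ENNReal.rpow_le_rpow h1 (by norm_num : (0 : ℝ) ≤ 2)
    rwa [← ENNReal.rpow_mul, ← ENNReal.rpow_mul, show (1 / 2 : ℝ) * 2 = 1 by norm_num,
      ENNReal.rpow_one, ENNReal.rpow_one] at this
  rw [← hNeq]
  exact hNA

end Lsc

end Summit.NavierStokesRegularity.NavierStokesRegularity.Theorems.QuarterBudgetTraceGradientLsc

end
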